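import Summits.QuantumFields.YangMills.Theorems.FluctuationComparisonRegPrIntLS2BetaRelativeWordStokes
import HarnessLib

/-!
# S2β · letter (D♮)∕(D-stage) REL-TEL, the (C)-half — THE THREE LOCAL SUPPLIERS OF THE RELATIVE KEY LEMMA (`hW`, `hA`, `hS` of ✓∕⧗`relKeyLemma_torus_hist`)
# AT ONE LEVEL: relative member LOOPS ⟸ px21 g23 ✓`dist1_loopHol_rel_le_local_SU` read from the BACKGROUND side (size × arc with the BKG size `θ₀`),
# relative axial ∕ staircase TRANSPORTS ⟸ px21 g23 ✓`dist1_holAt_walk_rel_le_local`; all three in the SUPPLIER SHAPE «`Σ_{near Q}`» of ✓p826622 ∕ ✓∕⧗`relHstep_hj_hist`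

Cell `ym3-torus` (rung R3 = continuum `SU(2)` Yang–Mills on the three-torus — NOT d = 4, NOT infinite volume, NOT a mass gap, NOT Clay).
Width seat «width 10» `ym3-torus-px10` (gen 24), FREE px helper on crux `stmt-QuantumFields-20520`, count-neutral, DEFINITION-FREE (0 `def`, 0 `instance`,
0 `notation`, 0 `sorry`); own-risk brick of the px10 lane (the KEYREL supplier road, UV3-NODE §82.7 (3)).

CONTENT (any `Params`, standing range `j + 1 ≤ m + K`; `near Q` = the fine bonds ∕ plaquettes whose block lies in the `3^d`-neighbourhood of `Q.src`).
* §1 geometry: ★`near_of_mem_three_blocks` — for each of the four bonds `c` of a coarse plaquette `Q`, the three blocks `B(c₋ − e_dir)`, `B(c₋)`, `B(c₊)` of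
  px21's local hypotheses lie in the `3^d`-neighbourhood of `Q.src` (coordinate bookkeeping on `Site.shift`∕`Site.unshift`).
* §2 ★★`loop_supplier_SU` — `dist1 (W_{c,i}(X₀)⁻¹·W_{c,i}(X)) ≤ K·(Σ_{near Q}δ + 2θ₀·(((d+2)L + 2)·Σ_{near Q}bdev))`, `K = ((d+2)L)²∕4`, for `PlaqSmall θ₀ X₀`
  (the SIZE is the background's: ✓`dist1_loopHol_rel_le_local_SU` applied to the pair `(X₀, X)` and read back with ✓`dist1_rel_comm`) — so the bdev
  coefficient `cWβ = K·2θ₀·((d+2)L+2)` is BKG-priced, the relative-plaquette coefficient is `cWε = K`.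
* §3 ★★`axial_supplier`, ★★`stair_supplier` — the relative straight transport of a bond of `Q` and the relative staircase transports from `emb Q.src` are
  `≤ (d+2)L·Σ_{near Q}bdev` (word lengths `L` ∕ `≤ d(L−1)∕2`; the walks stay in the three blocks by lit ✓`blockOf_walkEnd_of_count_le_loopWord`, the straight
  word and the staircase being sub-budgets of a (0.4) loop word).
EVERY right-hand side vanishes at `X = X₀`; no window, no smallness of the relative data is asked.

HONEST SCOPE.  Finite bookkeeping over landed pointwise letters; nothing of Bałaban's renormalisation analysis asserted; KEYREL, (H♭♭), (D-stage), GAP♯∘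
(`stub_uniformFibreGapOrbit`), S2β, crux 20520 and `YM3TorusSU2` are NOT proved; no registered stub is closed; the Yang–Mills mass gap is NOT proved.  Sorry-free,
axioms standard.  References: T. Bałaban, CMP **109** (1987) 249–301 [Balaban1987RG1] ((0.3)–(0.4) pp.252–253); CMP **99** (1985) 75–102 [Balaban1985RegularSpaces]
(Lemma 1 p.79).
-/

set_option autoImplicit false

noncomputable section

namespace Summit.QuantumFields.YangMills.Theorems.FluctuationComparisonRegPrIntLS2BetaRelativeKeyLemmaSuppliers

open Finset
open Literature.MathematicalPhysics.QuantumFieldTheory.Balaban1983to89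
open T4Continuum BlockAveraging AveragingRT
open T4TiltOscillation (bdev)
open BlockAveragingPlaquetteBoundLocal (blockOf_walkEnd_of_count_le_loopWord)
open LatticeWordStokes (length_stairWord_le)
open Summit.QuantumFields.YangMills.Theorems.FluctuationComparisonRegPrIntLS2BetaRelativeStokes (dist1_rel_comm)
open Summit.QuantumFields.YangMills.Theorems.FluctuationComparisonRegPrIntLS2BetaRelativeSwapDefect (dist1_holAt_walk_rel_le_local)
open Summit.QuantumFields.YangMills.Theorems.FluctuationComparisonRegPrIntLS2BetaRelativeWordStokes (dist1_loopHol_rel_le_local_SU)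

variable {P : Params} {j : ℕ}

/-! ## §1 Geometry: the three blocks of the four bonds of a coarse plaquette are `3^d`-near its source -/

/-- ★ For each of the four bonds `c` of the coarse plaquette `Q` and each of the three coarse sites `c₋ − e_dir`, `c₋`, `c₊`, every coordinate differs from
`Q.src`'s by `0` or `±1`. [folklore] -/
theorem near_of_mem_three_blocks (Q : Plaq P (j + 1)) (c : PBond P (j + 1))
    (hc : c = ⟨Q.src, Q.μ⟩ ∨ c = ⟨Q.src.shift Q.μ, Q.ν⟩ ∨ c = ⟨Q.src.shift Q.ν, Q.μ⟩ ∨ c = ⟨Q.src, Q.ν⟩)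
    (y : Site P (j + 1)) (hy : y = c.src.unshift c.dir ∨ y = c.src ∨ y = c.tgt) :
    ∀ κ, y κ = Q.src κ ∨ y κ = Q.src κ + 1 ∨ y κ = Q.src κ - 1 := by
  intro κ
  have hne : Q.μ ≠ Q.ν := Q.hμν.ne
  have hne' : Q.ν ≠ Q.μ := hne.symm
  by_cases h1 : κ = Q.μ
  · subst h1
    rcases hc with rfl | rfl | rfl | rfl <;> rcases hy with rfl | rfl | rfl <;>
      simp [PBond.tgt, Site.shift, Site.unshift, hne, hne']
  · by_cases h2 : κ = Q.ν
    · subst h2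
      rcases hc with rfl | rfl | rfl | rfl <;> rcases hy with rfl | rfl | rfl <;>
        simp [PBond.tgt, Site.shift, Site.unshift, hne, hne']
    · rcases hc with rfl | rfl | rfl | rfl <;> rcases hy with rfl | rfl | rfl <;>
        simp [PBond.tgt, Site.shift, Site.unshift, Function.update_apply, h1, h2]

/-- The same for the block of a fine site: `blockOf x ∈ {c₋ − e_dir, c₋, c₊}` ⟹ `blockOf x` is `3^d`-near `Q.src`. [folklore] -/
theorem near_blockOf_of_mem_three_blocks (Q : Plaq P (j + 1)) (c : PBond P (j + 1))
    (hc : c = ⟨Q.src, Q.μ⟩ ∨ c = ⟨Q.src.shift Q.μ, Q.ν⟩ ∨ c = ⟨Q.src.shift Q.ν, Q.μ⟩ ∨ c = ⟨Q.src, Q.ν⟩)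
    (x : Site P j) (hx : blockOf x = c.src.unshift c.dir ∨ blockOf x = c.src ∨ blockOf x = c.tgt) :
    ∀ κ, blockOf x κ = Q.src κ ∨ blockOf x κ = Q.src κ + 1 ∨ blockOf x κ = Q.src κ - 1 :=
  near_of_mem_three_blocks Q c hc (blockOf x) hx

/-! ## §2 The relative member loops, read from the background side -/

section SU

variable {n : Type*} [Fintype n] [DecidableEq n] [Nonempty n]

/-- ★★ **LOOP SUPPLIER** (`SU(N)`): for a coarse plaquette `Q`, one of its four bonds `c`, a member index `i`, and a pair `(X, X₀)` with `PlaqSmall θ₀ X₀`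
(`0 ≤ θ₀`, the BACKGROUND's size): `dist1 (W_{c,i}(X₀)⁻¹·W_{c,i}(X)) ≤ K·(Σ_{q near Q} δ_q + 2θ₀·(((d+2)L + 2)·Σ_{b near Q} dist1 (bdev X X₀ b)))`, `K = ((d+2)L)²∕4`,
`δ_q = dist1 (X₀(∂q)⁻¹·X(∂q))`. [cite: Balaban1987RG1, (0.3)-(0.4) pp.252-253] -/
theorem loop_supplier_SU (hj : j + 1 ≤ P.m + P.K) (X X₀ : GaugeField P j (Matrix.specialUnitaryGroup n ℂ)) {θ₀ : ℝ} (hθ₀ : 0 ≤ θ₀)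
    (hX₀ : PlaqSmall θ₀ X₀) (Q : Plaq P (j + 1)) (c : PBond P (j + 1))
    (hc : c = ⟨Q.src, Q.μ⟩ ∨ c = ⟨Q.src.shift Q.μ, Q.ν⟩ ∨ c = ⟨Q.src.shift Q.ν, Q.μ⟩ ∨ c = ⟨Q.src, Q.ν⟩) (i : Idx P) :
    dist1 ((loopHol X₀ c i)⁻¹ * loopHol X c i) ≤
      ((((P.d + 2) * P.L : ℕ) : ℝ) ^ 2 / 4) *
        (∑ q ∈ Finset.univ.filter (fun q : Plaq P j => ∀ κ, blockOf q.src κ = Q.src κ ∨ blockOf q.src κ = Q.src κ + 1 ∨ blockOf q.src κ = Q.src κ - 1),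
            dist1 ((GaugeField.plaqHol X₀ q)⁻¹ * GaugeField.plaqHol X q) +
          2 * θ₀ * (((((P.d + 2) * P.L : ℕ) : ℝ) + 2) *
            ∑ b ∈ Finset.univ.filter (fun b : PBond P j => ∀ κ, blockOf b.src κ = Q.src κ ∨ blockOf b.src κ = Q.src κ + 1 ∨ blockOf b.src κ = Q.src κ - 1),
              dist1 (bdev X X₀ b))) := by
  classical
  set ε : ℝ := ∑ q ∈ Finset.univ.filter (fun q : Plaq P j => ∀ κ, blockOf q.src κ = Q.src κ ∨ blockOf q.src κ = Q.src κ + 1 ∨ blockOf q.src κ = Q.src κ - 1),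
      dist1 ((GaugeField.plaqHol X₀ q)⁻¹ * GaugeField.plaqHol X q) with hε
  set η : ℝ := ∑ b ∈ Finset.univ.filter (fun b : PBond P j => ∀ κ, blockOf b.src κ = Q.src κ ∨ blockOf b.src κ = Q.src κ + 1 ∨ blockOf b.src κ = Q.src κ - 1),
      dist1 (bdev X X₀ b) with hη
  have hε0 : 0 ≤ ε := Finset.sum_nonneg fun q _ => GaugeGroup.dist1_nonneg _
  have hη0 : 0 ≤ η := Finset.sum_nonneg fun b _ => GaugeGroup.dist1_nonneg _
  -- px21's local letter on the pair `(X₀, X)`: the size is `X₀`'s, the relative data are symmetric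
  have hεq : ∀ q : Plaq P j, (blockOf q.src = c.src.unshift c.dir ∨ blockOf q.src = c.src ∨ blockOf q.src = c.tgt) →
      dist1 ((GaugeField.plaqHol X q)⁻¹ * GaugeField.plaqHol X₀ q) ≤ ε := fun q hq => by
    rw [dist1_rel_comm]
    exact Finset.single_le_sum (f := fun q : Plaq P j => dist1 ((GaugeField.plaqHol X₀ q)⁻¹ * GaugeField.plaqHol X q))
      (fun q _ => GaugeGroup.dist1_nonneg _) (Finset.mem_filter.mpr ⟨Finset.mem_univ q, near_blockOf_of_mem_three_blocks Q c hc q.src hq⟩)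
  have hηb : ∀ b : PBond P j, (blockOf b.src = c.src.unshift c.dir ∨ blockOf b.src = c.src ∨ blockOf b.src = c.tgt) →
      dist1 (bdev X₀ X b) ≤ η := fun b hb => by
    have e : dist1 (bdev X₀ X b) = dist1 (bdev X X₀ b) := by simp only [bdev]; exact (dist1_rel_comm _ _).symm
    rw [e]
    exact Finset.single_le_sum (f := fun b : PBond P j => dist1 (bdev X X₀ b))
      (fun b _ => GaugeGroup.dist1_nonneg _) (Finset.mem_filter.mpr ⟨Finset.mem_univ b, near_blockOf_of_mem_three_blocks Q c hc b.src hb⟩)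
  have h := dist1_loopHol_rel_le_local_SU X₀ X hθ₀ hε0 hη0 hj c (fun q _ => hX₀ q) hεq hηb i
  rw [dist1_rel_comm] at h
  exact h

end SU

/-! ## §3 The relative straight and staircase transports -/

section Transports

variable {G : Type*} [GaugeGroup G]

/-- The straight word of `L` steps `+e_μ` uses each letter at most as often as any (0.4) loop word at a bond of direction `μ`. [folklore] -/
theorem count_replicate_le_count_loopWord (L : ℕ) {d : ℕ} (μ : Fin d) (nn : Fin d → ℤ) (σ σ' : Equiv.Perm (Fin d)) (l : Letter d) :
    (List.replicate L (μ, true)).count l ≤ (loopWord L μ nn σ σ').count l := by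
  rw [loopWord, List.count_append, List.count_append]
  omega

/-- The staircase `Γ ∈ G(y, x)` uses each letter at most as often as the (0.4) loop word it opens. [folklore] -/
theorem count_stairWord_le_count_loopWord (L : ℕ) {d : ℕ} (μ : Fin d) (nn : Fin d → ℤ) (σ σ' : Equiv.Perm (Fin d)) (l : Letter d) :
    (stairWord σ nn).count l ≤ (loopWord L μ nn σ σ').count l := by
  rw [loopWord, List.count_append]
  omega

/-- ★★ **AXIAL SUPPLIER**: for one of the four bonds `c` of the coarse plaquette `Q`, the relative straight transport is bounded by `(d+2)L` times the sum of
the bond deviations over the `3^d`-neighbourhood of `Q.src`. [cite: Balaban1987RG1, (0.4) p.253] -/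
theorem axial_supplier (hj : j + 1 ≤ P.m + P.K) (X X₀ : GaugeField P j G) (Q : Plaq P (j + 1)) (c : PBond P (j + 1))
    (hc : c = ⟨Q.src, Q.μ⟩ ∨ c = ⟨Q.src.shift Q.μ, Q.ν⟩ ∨ c = ⟨Q.src.shift Q.ν, Q.μ⟩ ∨ c = ⟨Q.src, Q.ν⟩) :
    dist1 ((axialAvg X₀ c)⁻¹ * axialAvg X c) ≤
      (((P.d + 2) * P.L : ℕ) : ℝ) *
        ∑ b ∈ Finset.univ.filter (fun b : PBond P j => ∀ κ, blockOf b.src κ = Q.src κ ∨ blockOf b.src κ = Q.src κ + 1 ∨ blockOf b.src κ = Q.src κ - 1),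
          dist1 (bdev X X₀ b) := by
  classical
  set η : ℝ := ∑ b ∈ Finset.univ.filter (fun b : PBond P j => ∀ κ, blockOf b.src κ = Q.src κ ∨ blockOf b.src κ = Q.src κ + 1 ∨ blockOf b.src κ = Q.src κ - 1),
      dist1 (bdev X X₀ b) with hη
  have hη0 : 0 ≤ η := Finset.sum_nonneg fun b _ => GaugeGroup.dist1_nonneg _
  obtain ⟨i⟩ := (inferInstance : Nonempty (Idx P))
  rw [axialAvg_eq_holAt_walk, axialAvg_eq_holAt_walk]
  have h := dist1_holAt_walk_rel_le_local X X₀ (List.replicate P.L (c.dir, true)) (emb c.src) (η := η) (fun u hu μ => by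
    have hu' : ∀ l, u.count l ≤ (loopWord P.L c.dir (off i.1) i.2.1 i.2.2).count l :=
      fun l => (hu l).trans (count_replicate_le_count_loopWord P.L c.dir (off i.1) i.2.1 i.2.2 l)
    exact Finset.single_le_sum (f := fun b : PBond P j => dist1 (bdev X X₀ b)) (fun b _ => GaugeGroup.dist1_nonneg _)
      (Finset.mem_filter.mpr ⟨Finset.mem_univ _, near_blockOf_of_mem_three_blocks Q c hc _ (blockOf_walkEnd_of_count_le_loopWord hj c i u hu')⟩))
  refine h.trans ?_
  rw [List.length_replicate]
  exact mul_le_mul_of_nonneg_right (by exact_mod_cast Nat.le_mul_of_pos_left P.L (by omega)) hη0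

/-- ★★ **STAIRCASE SUPPLIER**: the relative staircase transports `Γ ∈ G(Q.src, x)` from `emb Q.src` are bounded by `(d+2)L` times the sum of the bond
deviations over the `3^d`-neighbourhood of `Q.src`. [cite: Balaban1987RG1, (0.3) p.252] -/
theorem stair_supplier (hj : j + 1 ≤ P.m + P.K) (X X₀ : GaugeField P j G) (Q : Plaq P (j + 1)) (i : Idx P) :
    dist1 ((holAt X₀ (walk (emb Q.src) (stairWord i.2.1 (off i.1))))⁻¹ * holAt X (walk (emb Q.src) (stairWord i.2.1 (off i.1)))) ≤
      (((P.d + 2) * P.L : ℕ) : ℝ) *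
        ∑ b ∈ Finset.univ.filter (fun b : PBond P j => ∀ κ, blockOf b.src κ = Q.src κ ∨ blockOf b.src κ = Q.src κ + 1 ∨ blockOf b.src κ = Q.src κ - 1),
          dist1 (bdev X X₀ b) := by
  classical
  set η : ℝ := ∑ b ∈ Finset.univ.filter (fun b : PBond P j => ∀ κ, blockOf b.src κ = Q.src κ ∨ blockOf b.src κ = Q.src κ + 1 ∨ blockOf b.src κ = Q.src κ - 1),
      dist1 (bdev X X₀ b) with hη
  have hη0 : 0 ≤ η := Finset.sum_nonneg fun b _ => GaugeGroup.dist1_nonneg _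
  -- the staircase opens the loop word at the bond `⟨Q.src, Q.μ⟩` (one of the four)
  set c : PBond P (j + 1) := ⟨Q.src, Q.μ⟩ with hc
  have h := dist1_holAt_walk_rel_le_local X X₀ (stairWord i.2.1 (off i.1)) (emb Q.src) (η := η) (fun u hu μ => by
    have hu' : ∀ l, u.count l ≤ (loopWord P.L c.dir (off i.1) i.2.1 i.2.2).count l :=
      fun l => (hu l).trans (count_stairWord_le_count_loopWord P.L c.dir (off i.1) i.2.1 i.2.2 l)
    have hb := blockOf_walkEnd_of_count_le_loopWord hj c i u hu'
    exact Finset.single_le_sum (f := fun b : PBond P j => dist1 (bdev X X₀ b)) (fun b _ => GaugeGroup.dist1_nonneg _)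
      (Finset.mem_filter.mpr ⟨Finset.mem_univ _, near_blockOf_of_mem_three_blocks Q c (Or.inl rfl) _ hb⟩))
  refine h.trans (mul_le_mul_of_nonneg_right ?_ hη0)
  have hN : ∀ ν, (off i.1 ν).natAbs ≤ (P.L - 1) / 2 := fun ν => by have h := off_bounds i.1 ν; omega
  have hlen := length_stairWord_le i.2.1 (off i.1) _ hN
  have h2 : P.d * ((P.L - 1) / 2) ≤ (P.d + 2) * P.L := by
    have : (P.L - 1) / 2 ≤ P.L := by omega
    calc P.d * ((P.L - 1) / 2) ≤ P.d * P.L := Nat.mul_le_mul_left _ this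
      _ ≤ (P.d + 2) * P.L := Nat.mul_le_mul_right _ (by omega)
  exact_mod_cast hlen.trans h2

end Transports

end Summit.QuantumFields.YangMills.Theorems.FluctuationComparisonRegPrIntLS2BetaRelativeKeyLemmaSuppliers

end
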